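import Summits.ResolutionOfSingularities.ResolutionOfSingularities.Theorems.PurelyInseparableDim4ResConeLightPairVirtualStep
import Summits.ResolutionOfSingularities.ResolutionOfSingularities.Theorems.PurelyInseparableDim4ResConeLossFreeTail
import Summits.ResolutionOfSingularities.ResolutionOfSingularities.Theorems.PurelyInseparableDim4ResConeCInfAssembly
import Summits.ResolutionOfSingularities.ResolutionOfSingularities.Theorems.PurelyInseparableDim4Equimultiple
import HarnessLib
import HarnessLib.Audit.Tags

/-!
# Purely inseparable four-folds — THE (5,4) LIGHT-PAIR TAIL IS EMPTY MODULO ONE TT TIME (slice C, hN4-C′ file 3): the honest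
# loss-free re-presentation built forward, and C13's kill
# (cell `res-dim4-pi`, K2(p) lane, slice C; hN4-C′ = light-pair `(5,4)` re-presentation)

[OURS · counted 0 · cell `res-dim4-pi` · K2(p) lane (LEDGER v8.2: hN4-C′ = res-dim4-p-3); over `…ResConeLightPairVirtualStep`
(res-dim4-typ-1 g3's transport core + the kernel rigidity) and res-dim4-p-5 g3's C13 `ResCone.no_lossfree_tail`; the ENTRY TT is the
one named residual (res-dim4-p-5 g4: «TT ONCE at entry», `…ResConeTTPersist`); seat res-dim4-p-3 g4.]  Nothing here proves K2(p)/K2(5),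
`NoIsolatedTrap 5 5`, TAIL-D or resolution of singularities in dimension ≥ 4 / characteristic `p` — NOT proved.  AI kernel work,
weaker than expert review.

**`no_light_pair_tail_four_five_of_TT`.**  Along a witnessed isolated above-floor `Step0 5` chain with `x^{r₀} ∣ F₀`, shade `≡ 4`,
`e_G ≡ 2` and two weight-`1` letters from `k₀` (the LIGHT-PAIR `(5,4)` class of W₄), suppose that at ONE time `kₑ ≥ k₀`, `kₑ ≥ 1`, the
polar kernel has no non-zero vector vanishing on both boundary letters (TT).  Then `False`.  ROUTE: the virtual chain
`B₀ := c kₑ`, `B_{t+1} := step 5 univ ℓ_t β_t B_t` (`lightPair_virtual_step`, the data chosen by `Classical.epsilon`, plain `Nat.rec`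
— no `def`) is an HONEST witnessed isolated shade-`4` `e_G = 2` chain whose charts are the two slots and whose translations live
on the free letters — LOSS-FREE — so res-dim4-p-5 g3's C13 `no_lossfree_tail 5` kills it.
**`lightPair_representation_of_TT`** — the same, in the dress of the hN4-C′ socket (`no_light_pair_tail_of_representation`):
the loss-free re-presentation EXISTS (vacuously).

[cite: CossartJannsenSaito2020, Thm. 3.10(4), Thm. 3.14] [cite: Hauser2010, §§F–G]
bears_on: LADDER-RESOLUTION:D157-DOOR2 (res-dim4-pi · K2(p) slice C · hN4-C′ modulo one TT time).
Supports stmt-ResolutionOfSingularities-16155 (helper).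
-/

set_option linter.dupNamespace false -- mandated namespace of this single-conjunct summit

noncomputable section

namespace Summit.ResolutionOfSingularities.ResolutionOfSingularities.Theorems.PIDim4

namespace ResCone

open MvPolynomial Finset
open Literature.AlgebraicGeometry.Resolution
open Literature.AlgebraicGeometry.Resolution.CentreBlowup
open Literature.AlgebraicGeometry.Resolution.Hauser2010
open Literature.AlgebraicGeometry.Resolution.HauserPerlega2019

variable {K : Type} [Field K] [CharP K 5] [DecidableEq K]

/-- **THE (5,4) LIGHT-PAIR TAIL IS EMPTY MODULO ONE TT TIME** (statement and route in the module docstring). [OURS]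
[cite: CossartJannsenSaito2020, Thm. 3.14] [cite: Hauser2010, §§F–G] -/
theorem no_light_pair_tail_four_five_of_TT {c : ℕ → State K} {j : ℕ → Fin 4} {b : ℕ → Fin 4 → K}
    (hc : ∀ k, IsIsolated 5 (c k).F ∧ Step0 5 (c k) (c (k + 1))) (hw : FreeTail.IsWitnessedChain 5 c j b)
    (hr0 : ∀ e ∈ (c 0).F.support, (c 0).r ≤ e) (hfloor : ∀ k, ordZero (c k).F ≠ (5 : ℕ)) {k₀ : ℕ}
    (hshade : ∀ k, k₀ ≤ k → (c k).shade = ((4 : ℕ) : ℕ∞))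
    (he : ∀ k, k₀ ≤ k → Module.finrank K (resVertex (c k)) = 2)
    (hwt : ∀ k, k₀ ≤ k → (∀ i, (c k).r i ≤ 1) ∧ (c k).r.degree = 2)
    (hTT : ∃ kₑ, k₀ ≤ kₑ ∧ 1 ≤ kₑ ∧ ∀ v ∈ resVertex (c kₑ), (∀ i, 1 ≤ (c kₑ).r i → v i = 0) → v = 0) : False := by
  haveI : Fact (Nat.Prime 5) := ⟨by norm_num⟩
  obtain ⟨kₑ, hkₑ, hkₑ1, hTTₑ⟩ := hTT
  -- (0) chain facts
  have hiso : ∀ k, IsIsolated 5 (c k).F := fun k => (hc k).1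
  have hbj : ∀ k, b k (j k) = 0 := fun k => (hw k).2.1
  have hstep : ∀ k, c (k + 1) = CentreBlowup.step 5 Finset.univ (j k) (b k) (c k) := fun k => (hw k).2.2.2.2
  have hdivk : ∀ k, ∀ e ∈ (c k).F.support, (c k).r ≤ e := IsolatedBand.isolated_chain_forall_le hc hr0
  have ho6 : ∀ k, k₀ ≤ k → ordZero (c k).F = 6 := fun k hk => by
    obtain ⟨o, ho, hpo, -, hod⟩ := chain_shade_nat 5 hc hfloor hshade hk
    rw [(hwt k hk).2] at hod
    rw [ho]
    have : o = 6 := by omega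
    rw [this]; rfl
  -- (1) the letters: slots `a a′` of `c kₑ`, free letters `u f`
  obtain ⟨a, a', haa', hrₑ⟩ := exists_pair_letters (hwt kₑ hkₑ).1 (hwt kₑ hkₑ).2
  obtain ⟨u, -, hu⟩ : ∃ u ∈ (Finset.univ : Finset (Fin 4)), u ∉ ({a, a'} : Finset (Fin 4)) :=
    Finset.exists_mem_notMem_of_card_lt_card (by
      rw [Finset.card_univ, Fintype.card_fin]
      exact lt_of_le_of_lt ((Finset.card_insert_le _ _).trans (le_of_eq (by rw [Finset.card_singleton]))) (by norm_num))
  rw [Finset.mem_insert, Finset.mem_singleton, not_or] at hu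
  obtain ⟨hua, hua'⟩ := hu
  obtain ⟨f, hfa, hfa', hfu, -⟩ := exists_fourth_letter haa' (Ne.symm hua) (Ne.symm hua')
  have hau : a ≠ u := Ne.symm hua
  have ha'u : a' ≠ u := Ne.symm hua'
  have haf : a ≠ f := Ne.symm hfa
  have ha'f : a' ≠ f := Ne.symm hfa'
  have huf : u ≠ f := Ne.symm hfu
  have hTTa : ∀ v ∈ resVertex (c kₑ), v a = 0 → v a' = 0 → v = 0 := fun v hv hva hva' =>
    hTTₑ v hv fun i hi => by
      rw [hrₑ, Finsupp.add_apply, Finsupp.single_apply, Finsupp.single_apply] at hi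
      by_cases hia : a = i
      · rw [← hia]; exact hva
      · by_cases hia' : a' = i
        · rw [← hia']; exact hva'
        · rw [if_neg hia, if_neg hia'] at hi; omega
  have hcleanₑ : deletePthPowers 5 (c kₑ).F = (c kₑ).F := by
    obtain ⟨k'', rfl⟩ : ∃ k'', kₑ = k'' + 1 := ⟨kₑ - 1, by omega⟩
    rw [hstep k'']
    exact FrameChange.deletePthPowers_step_F 5 Finset.univ (j k'') (b k'') (c k'')
  -- (2) the step predicate `Q t dt x` (the conclusion of `lightPair_virtual_step` at real time `kₑ + t`)
  obtain ⟨Q, hQ⟩ : ∃ Q : ℕ → Equiv.Perm (Fin 4) × State K → Fin 4 × (Fin 4 → K) × Equiv.Perm (Fin 4) → Prop,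
      ∀ t dt x, Q t dt x ↔
        ((x.1 = a ∨ x.1 = a') ∧ x.2.1 a = 0 ∧ x.2.1 a' = 0 ∧
          (c (kₑ + t + 1)).r = Finsupp.single (x.2.2 a) 1 + Finsupp.single (x.2.2 a') 1 ∧
          (∀ M : ℕ, ∃ (θ e : Fin 4 → MvPolynomial (Fin 4) K) (U E : MvPolynomial (Fin 4) K),
              θ (x.2.2 a) = X a * e a ∧ θ (x.2.2 a') = X a' * e a' ∧
              constantCoeff (e a) ≠ 0 ∧ constantCoeff (e a') ≠ 0 ∧
              constantCoeff (θ (x.2.2 u)) = 0 ∧ constantCoeff (θ (x.2.2 f)) = 0 ∧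
              coeff (Finsupp.single u 1) (θ (x.2.2 u)) * coeff (Finsupp.single f 1) (θ (x.2.2 f)) -
                coeff (Finsupp.single f 1) (θ (x.2.2 u)) * coeff (Finsupp.single u 1) (θ (x.2.2 f)) ≠ 0 ∧
              constantCoeff U ≠ 0 ∧ E ∈ originIdeal K ^ M ∧ (CentreBlowup.step 5 Finset.univ x.1 x.2.1 dt.2).F = deletePthPowers 5 (U ^ 5 * aeval θ (c (kₑ + t + 1)).F) + E) ∧
          ordZero (CentreBlowup.step 5 Finset.univ x.1 x.2.1 dt.2).F = 6 ∧
          (CentreBlowup.step 5 Finset.univ x.1 x.2.1 dt.2).r = Finsupp.single a 1 + Finsupp.single a' 1 ∧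
          (∀ d ∈ (CentreBlowup.step 5 Finset.univ x.1 x.2.1 dt.2).F.support, (CentreBlowup.step 5 Finset.univ x.1 x.2.1 dt.2).r ≤ d) ∧
          IsIsolated 5 (CentreBlowup.step 5 Finset.univ x.1 x.2.1 dt.2).F ∧
          Module.finrank K (resVertex (CentreBlowup.step 5 Finset.univ x.1 x.2.1 dt.2)) = 2 ∧
          (∀ v ∈ resVertex (CentreBlowup.step 5 Finset.univ x.1 x.2.1 dt.2), v a = 0 → v a' = 0 → v = 0)) :=
    ⟨_, fun _ _ _ => Iff.rfl⟩
  -- (3) the virtual data by recursion (`Classical.epsilon`, plain `Nat.rec`)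
  obtain ⟨sq, hd0, hds⟩ : ∃ sq : ℕ → Equiv.Perm (Fin 4) × State K, sq 0 = ((1 : Equiv.Perm (Fin 4)), c kₑ) ∧
      ∀ t, sq (t + 1) = ((Classical.epsilon (Q t (sq t))).2.2,
        CentreBlowup.step 5 Finset.univ (Classical.epsilon (Q t (sq t))).1 (Classical.epsilon (Q t (sq t))).2.1 (sq t).2) :=
    ⟨fun t => Nat.rec ((1 : Equiv.Perm (Fin 4)), c kₑ) (fun t dt => ((Classical.epsilon (Q t dt)).2.2,
      CentreBlowup.step 5 Finset.univ (Classical.epsilon (Q t dt)).1 (Classical.epsilon (Q t dt)).2.1 dt.2)) t,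
      rfl, fun _ => rfl⟩
  -- (4) the invariant, by induction
  have hINV : ∀ t,
      (c (kₑ + t)).r = Finsupp.single ((sq t).1 a) 1 + Finsupp.single ((sq t).1 a') 1 ∧
        (∀ M : ℕ, ∃ (θ e : Fin 4 → MvPolynomial (Fin 4) K) (U E : MvPolynomial (Fin 4) K),
            θ ((sq t).1 a) = X a * e a ∧ θ ((sq t).1 a') = X a' * e a' ∧
            constantCoeff (e a) ≠ 0 ∧ constantCoeff (e a') ≠ 0 ∧
            constantCoeff (θ ((sq t).1 u)) = 0 ∧ constantCoeff (θ ((sq t).1 f)) = 0 ∧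
            coeff (Finsupp.single u 1) (θ ((sq t).1 u)) * coeff (Finsupp.single f 1) (θ ((sq t).1 f)) -
              coeff (Finsupp.single f 1) (θ ((sq t).1 u)) * coeff (Finsupp.single u 1) (θ ((sq t).1 f)) ≠ 0 ∧
            constantCoeff U ≠ 0 ∧ E ∈ originIdeal K ^ M ∧ (sq t).2.F = deletePthPowers 5 (U ^ 5 * aeval θ (c (kₑ + t)).F) + E) ∧
        ordZero (sq t).2.F = 6 ∧ (sq t).2.r = Finsupp.single a 1 + Finsupp.single a' 1 ∧
        (∀ d ∈ (sq t).2.F.support, (sq t).2.r ≤ d) ∧ IsIsolated 5 (sq t).2.F ∧ Module.finrank K (resVertex (sq t).2) = 2 ∧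
        (∀ v ∈ resVertex (sq t).2, v a = 0 → v a' = 0 → v = 0) := by
    intro t
    induction t with
    | zero =>
      have h1 : (sq 0).1 = 1 := by rw [hd0]
      have h2 : (sq 0).2 = c kₑ := by rw [hd0]
      rw [h1, h2, Nat.add_zero]
      refine ⟨?_, fun M => lightPair_rel_refl hcleanₑ hau haf ha'u ha'f huf M, ho6 kₑ hkₑ, hrₑ, hdivk kₑ, hiso kₑ,
        he kₑ hkₑ, hTTa⟩
      rw [Equiv.Perm.one_apply, Equiv.Perm.one_apply]; exact hrₑ
    | succ t ih =>
      obtain ⟨hrA, hrel, hoB, hrB, hdivB, -, -, hTTB⟩ := ih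
      have hkt : k₀ ≤ kₑ + t := by omega
      have hkt1 : k₀ ≤ kₑ + t + 1 := by omega
      have hex : ∃ x, Q t (sq t) x := by
        obtain ⟨ℓ, β, π', h⟩ := lightPair_virtual_step haa' hau haf ha'u ha'f huf (π := (sq t).1) (A := c (kₑ + t))
          (A' := c (kₑ + t + 1)) (B := (sq t).2) (jr := j (kₑ + t)) (b := b (kₑ + t)) (hbj (kₑ + t)) (hstep (kₑ + t))
          (ho6 (kₑ + t) hkt) (ho6 (kₑ + t + 1) hkt1) (hiso (kₑ + t + 1)) (he (kₑ + t + 1) hkt1) (hwt (kₑ + t + 1) hkt1).1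
          (hwt (kₑ + t + 1) hkt1).2 (hdivk (kₑ + t + 1)) hrA hrel hoB hrB hdivB hTTB
        exact ⟨(ℓ, β, π'), (hQ t (sq t) (ℓ, β, π')).mpr h⟩
      have hspec := (hQ t (sq t) _).mp (Classical.epsilon_spec hex)
      obtain ⟨-, -, -, hrA', hrel', ho', hr', hdiv', hiso', he', hTT'⟩ := hspec
      rw [hds t]
      rw [show kₑ + (t + 1) = kₑ + t + 1 from rfl]
      exact ⟨hrA', hrel', ho', hr', hdiv', hiso', he', hTT'⟩
  -- (5) the virtual chain as a witnessed loss-free light chain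
  have hex : ∀ t, ∃ x, Q t (sq t) x := fun t => by
    obtain ⟨hrA, hrel, hoB, hrB, hdivB, -, -, hTTB⟩ := hINV t
    obtain ⟨ℓ, β, π', h⟩ := lightPair_virtual_step haa' hau haf ha'u ha'f huf (π := (sq t).1) (A := c (kₑ + t))
      (A' := c (kₑ + t + 1)) (B := (sq t).2) (jr := j (kₑ + t)) (b := b (kₑ + t)) (hbj (kₑ + t)) (hstep (kₑ + t))
      (ho6 (kₑ + t) (by omega)) (ho6 (kₑ + t + 1) (by omega)) (hiso (kₑ + t + 1)) (he (kₑ + t + 1) (by omega))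
      (hwt (kₑ + t + 1) (by omega)).1 (hwt (kₑ + t + 1) (by omega)).2 (hdivk (kₑ + t + 1)) hrA hrel hoB hrB hdivB hTTB
    exact ⟨(ℓ, β, π'), (hQ t (sq t) (ℓ, β, π')).mpr h⟩
  have hspec : ∀ t, Q t (sq t) (Classical.epsilon (Q t (sq t))) := fun t => Classical.epsilon_spec (hex t)
  have hsucc : ∀ t, (sq (t + 1)).2 = CentreBlowup.step 5 Finset.univ (Classical.epsilon (Q t (sq t))).1
      (Classical.epsilon (Q t (sq t))).2.1 (sq t).2 := fun t => by rw [hds t]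
  have hℓ : ∀ t, (Classical.epsilon (Q t (sq t))).1 = a ∨ (Classical.epsilon (Q t (sq t))).1 = a' := fun t =>
    ((hQ t (sq t) _).mp (hspec t)).1
  have hβa : ∀ t, (Classical.epsilon (Q t (sq t))).2.1 a = 0 := fun t => ((hQ t (sq t) _).mp (hspec t)).2.1
  have hβa' : ∀ t, (Classical.epsilon (Q t (sq t))).2.1 a' = 0 := fun t => ((hQ t (sq t) _).mp (hspec t)).2.2.1
  have hoV : ∀ t, ordZero (sq t).2.F = 6 := fun t => (hINV t).2.2.1
  have hrV : ∀ t, (sq t).2.r = Finsupp.single a 1 + Finsupp.single a' 1 := fun t => (hINV t).2.2.2.1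
  have hdivV : ∀ t, ∀ e ∈ (sq t).2.F.support, (sq t).2.r ≤ e := fun t => (hINV t).2.2.2.2.1
  have hisoV : ∀ t, IsIsolated 5 (sq t).2.F := fun t => (hINV t).2.2.2.2.2.1
  have heV : ∀ t, Module.finrank K (resVertex (sq t).2) = 2 := fun t => (hINV t).2.2.2.2.2.2.1
  have hβj : ∀ t, (Classical.epsilon (Q t (sq t))).2.1 (Classical.epsilon (Q t (sq t))).1 = 0 := fun t => by
    rcases hℓ t with h | h <;> rw [h]
    exacts [hβa t, hβa' t]
  have h5le : ∀ t, ((5 : ℕ) : ℕ∞) ≤ ordAlong Finset.univ (sq t).2.F := fun t => by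
    rw [ordAlong_univ, hoV t]; exact_mod_cast (by norm_num : 5 ≤ 6)
  have hequi : ∀ t, IsEquimultiplePoint 5 Finset.univ (Classical.epsilon (Q t (sq t))).1 (Classical.epsilon (Q t (sq t))).2.1
      (sq t).2 := fun t => by
    rw [Equimultiple.isEquimultiplePoint_iff_le_ordZero_step, ← hsucc t, hoV (t + 1)]
    exact_mod_cast (by norm_num : 5 ≤ 6)
  have hne : ∀ t, (CentreBlowup.step 5 Finset.univ (Classical.epsilon (Q t (sq t))).1 (Classical.epsilon (Q t (sq t))).2.1
      (sq t).2).F ≠ 0 := fun t h0 => by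
    have h := hoV (t + 1)
    rw [hsucc t, h0, ordZero_zero] at h
    exact ENat.top_ne_coe 6 (by exact_mod_cast h)
  have hw' : FreeTail.IsWitnessedChain 5 (fun t => (sq t).2) (fun t => (Classical.epsilon (Q t (sq t))).1)
      (fun t => (Classical.epsilon (Q t (sq t))).2.1) := fun t => ⟨h5le t, hβj t, hequi t, hne t, hsucc t⟩
  have hc' : ∀ t, IsIsolated 5 (sq t).2.F ∧ Step0 5 (sq t).2 (sq (t + 1)).2 := fun t =>
    ⟨hisoV t, h5le t, (Classical.epsilon (Q t (sq t))).1, (Classical.epsilon (Q t (sq t))).2.1, Finset.mem_univ _, hβj t,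
      hequi t, hne t, hsucc t⟩
  have hfloor' : ∀ t, ordZero (sq t).2.F ≠ (5 : ℕ) := fun t => by
    rw [hoV t]; exact_mod_cast (by norm_num : (6 : ℕ) ≠ 5)
  have hshade' : ∀ t, 0 ≤ t → (sq t).2.shade = ((4 : ℕ) : ℕ∞) := fun t _ => by
    rw [BandShade.shade_eq_coe (hoV t), hrV t, degree_pair_eq_two]
  have hloss' : ∀ t, 0 ≤ t → ∀ i, (Classical.epsilon (Q t (sq t))).2.1 i ≠ 0 → (sq t).2.r i = 0 := fun t _ i hi => by
    have hia : a ≠ i := fun h => hi (by rw [← h]; exact hβa t)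
    have hia' : a' ≠ i := fun h => hi (by rw [← h]; exact hβa' t)
    rw [hrV t, Finsupp.add_apply, Finsupp.single_eq_of_ne hia.symm, Finsupp.single_eq_of_ne hia'.symm, add_zero]
  have hr0' : ∀ e ∈ (sq 0).2.F.support, (sq 0).2.r ≤ e := hdivV 0
  exact no_lossfree_tail 5 hc' hw' hr0' hfloor' (d := 4) (by norm_num) (k₀ := 0) hshade' (fun t _ => heV t) hloss'

/-- **hN4-C′ MODULO ONE TT TIME, in the socket's dress**: under the same hypotheses the LOSS-FREE re-presentation demanded by
`no_light_pair_tail_of_representation` exists (vacuously). [OURS] [cite: CossartJannsenSaito2020, Thm. 3.14] -/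
theorem lightPair_representation_of_TT {c : ℕ → State K} {j : ℕ → Fin 4} {b : ℕ → Fin 4 → K}
    (hc : ∀ k, IsIsolated 5 (c k).F ∧ Step0 5 (c k) (c (k + 1))) (hw : FreeTail.IsWitnessedChain 5 c j b)
    (hr0 : ∀ e ∈ (c 0).F.support, (c 0).r ≤ e) (hfloor : ∀ k, ordZero (c k).F ≠ (5 : ℕ)) {k₀ : ℕ}
    (hshade : ∀ k, k₀ ≤ k → (c k).shade = ((4 : ℕ) : ℕ∞))
    (he : ∀ k, k₀ ≤ k → Module.finrank K (resVertex (c k)) = 2)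
    (hwt : ∀ k, k₀ ≤ k → (∀ i, (c k).r i ≤ 1) ∧ (c k).r.degree = 2)
    (hTT : ∃ kₑ, k₀ ≤ kₑ ∧ 1 ≤ kₑ ∧ ∀ v ∈ resVertex (c kₑ), (∀ i, 1 ≤ (c kₑ).r i → v i = 0) → v = 0) :
    ∃ (c' : ℕ → State K) (j' : ℕ → Fin 4) (b' : ℕ → Fin 4 → K) (k₀' : ℕ),
      (∀ k, IsIsolated 5 (c' k).F ∧ Step0 5 (c' k) (c' (k + 1))) ∧ FreeTail.IsWitnessedChain 5 c' j' b' ∧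
      (∀ e ∈ (c' 0).F.support, (c' 0).r ≤ e) ∧ (∀ k, ordZero (c' k).F ≠ (5 : ℕ)) ∧
      (∀ k, k₀' ≤ k → (c' k).shade = ((4 : ℕ) : ℕ∞)) ∧
      (∀ k, k₀' ≤ k → Module.finrank K (resVertex (c' k)) = 2) ∧
      (∀ k, k₀' ≤ k → ∀ i, b' k i ≠ 0 → (c' k).r i = 0) :=
  (no_light_pair_tail_four_five_of_TT hc hw hr0 hfloor hshade he hwt hTT).elim

end ResCone

end Summit.ResolutionOfSingularities.ResolutionOfSingularities.Theorems.PIDim4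

end
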